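import Literature.Analysis.FluidPDE.PeriodicSwirlMoserStep
import Literature.Analysis.FluidPDE.LeiZhang2011TimeArgument
import HarnessLib

/-!
# Lei–Ren–Zhang 2019, proof of Lemma 3.1: the mass on the half period box

Analysis/FluidPDE proofs file (theorems only, no definitions, no named facts), on the discharge
path of the named fact `Literature.Analysis.FluidPDE.leiRenZhang2019_liouville_periodic`
(Z. Lei, X. Ren, Q. S. Zhang, arXiv:1902.11229 = Math. Ann. 383 (2022), Theorem 1.1). In the proof
of Lemma 3.1 (arXiv pp. 7–8) the hypothesis (3.1) "`‖Λ‖_{L¹(P_{R/2})} ≥ m₀R⁴`" is turned into a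
lower bound for `∫ ζ_R² Λ` on a set `W` of times of positive measure ((3.11)–(3.12): "we just
used `|D_R| ∼ R²`"). In the tree (as for `LeiZhang2011.log_estimate`) the time-slice step is:
from `θ ≤ ∫_{K₂} F^{1/4}` over the compact half period box `K₂ = {0 ≤ x₂ ≤ P, r ≤ ρ/2}` to
`(16/27) θ⁴/(ρ²P)³ ≤ ∫_{slab} F ζ²` (`ζ = cylCutoff (ρ/2) ρ`, Hölder
`setIntegral_ge_of_setIntegral_rpow_quarter`, `|K₂| ≤ ρ²P`, `ζ = 1` on `K₂`), together with the
geometry of `K₂` (compact, `ρ²P/4 ≤ |K₂| ≤ ρ²P`) and the continuity in time of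
`s ↦ ∫_{K₂} F(s)^{1/4}` for a jointly continuous `F` (used by `measureReal_superlevel_ge`).

* `isCompact_halfPeriodBox`, `volume_real_halfPeriodBox`,
  `continuous_setIntegral_halfPeriodBox_rpow_quarter`, `slab_mass_of_quarter_mass_periodic`.

## References

* Z. Lei, X. Ren, Q. S. Zhang, arXiv:1902.11229, §3, (3.1) and (3.11)–(3.12) (arXiv pp. 7–8).
  [LeiRenZhang2019]
-/

noncomputable section

open MeasureTheory Set Function Filter Metric
open _root_.Topology
open scoped ENNReal

namespace Literature.Analysis.FluidPDE

namespace LeiRenZhang2019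

open LeiZhang2011

/-- The box `{|x₀| ≤ a, |x₁| ≤ a, 0 ≤ x₂ ≤ P}` has volume `2a · 2a · P`. [folklore] -/
private theorem volume_box_Icc_phb {a P : ℝ} (ha : 0 ≤ a) :
    volume {x : EuclideanSpace ℝ (Fin 3) | |x 0| ≤ a ∧ |x 1| ≤ a ∧ x 2 ∈ Icc 0 P} =
      ENNReal.ofReal (2 * a * (2 * a) * P) := by
  classical
  have hset : {x : EuclideanSpace ℝ (Fin 3) | |x 0| ≤ a ∧ |x 1| ≤ a ∧ x 2 ∈ Icc 0 P} =
      (WithLp.ofLp : EuclideanSpace ℝ (Fin 3) → (Fin 3 → ℝ)) ⁻¹'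
        Set.univ.pi (fun i : Fin 3 => if i = 2 then Icc 0 P else Icc (-a) a) := by
    ext x
    simp only [mem_setOf_eq, mem_preimage, mem_univ_pi]
    constructor
    · rintro ⟨h0, h1, h2⟩ i
      fin_cases i
      · simpa [abs_le] using h0
      · simpa [abs_le] using h1
      · simpa using h2
    · intro h
      have h0 := h 0
      have h1 := h 1
      have h2 := h 2
      simp only [Fin.isValue, Fin.reduceEq, ↓reduceIte, mem_Icc] at h0 h1 h2
      exact ⟨abs_le.2 h0, abs_le.2 h1, h2⟩
  have hmeas : MeasurableSet (Set.univ.pi (fun i : Fin 3 => if i = 2 then Icc (0 : ℝ) P else Icc (-a) a)) :=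
    MeasurableSet.univ_pi fun i => by
      by_cases hi : i = 2
      · simp only [hi, ↓reduceIte]; exact measurableSet_Icc
      · simp only [hi, ↓reduceIte]; exact measurableSet_Icc
  rw [hset, (PiLp.volume_preserving_ofLp (Fin 3)).measure_preimage hmeas.nullMeasurableSet,
    volume_pi, Measure.pi_pi, Fin.prod_univ_three]
  simp only [Fin.isValue, Fin.reduceEq, ↓reduceIte, Real.volume_Icc, sub_neg_eq_add, sub_zero]
  rw [← ENNReal.ofReal_mul (by linarith), ← ENNReal.ofReal_mul (by positivity)]
  congr 1; ring

/-- `|x₀|, |x₁| ≤ r`. [folklore] -/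
private theorem abs_apply_le_cylRadius_phb (x : EuclideanSpace ℝ (Fin 3)) :
    |x 0| ≤ cylRadius x ∧ |x 1| ≤ cylRadius x := by
  rw [cylRadius]
  exact ⟨Real.abs_le_sqrt (by nlinarith [sq_nonneg (x 1)]), Real.abs_le_sqrt (by nlinarith [sq_nonneg (x 0)])⟩

/-- **The half period box `K = {0 ≤ x₂ ≤ P, r ≤ ρ}` is compact** (print's `D_R × [0, Z₀]` per
period, closed). [cite: LeiRenZhang2019, §2 before (2.1) (P_{R,T} = {(x,t) : r < R, −T < t < 0}, all z by periodicity; one period D_R ∼ R²), arXiv p. 5] -/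
theorem isCompact_halfPeriodBox (P ρ : ℝ) :
    IsCompact {x : EuclideanSpace ℝ (Fin 3) | x 2 ∈ Icc 0 P ∧ cylRadius x ≤ ρ} := by
  have hx2 : Continuous fun x : EuclideanSpace ℝ (Fin 3) => x 2 :=
    (EuclideanSpace.proj (𝕜 := ℝ) (2 : Fin 3)).continuous
  refine Metric.isCompact_of_isClosed_isBounded ?_ ?_
  · exact (isClosed_Icc.preimage hx2).inter (isClosed_le continuous_cylRadius continuous_const)
  · refine (Metric.isBounded_closedBall (x := (0 : EuclideanSpace ℝ (Fin 3))) (r := ρ + |P|)).subset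
      fun x hx => ?_
    rw [mem_closedBall_zero_iff]
    have h := norm_le_cylRadius_add_abs_apply_two x
    have h2 : |x 2| ≤ |P| := by
      rw [abs_le]
      exact ⟨by linarith [hx.1.1, abs_nonneg P], hx.1.2.trans (le_abs_self P)⟩
    linarith [hx.2]

/-- **Volume of the period box** ("`|D_R| ∼ R²`" per period): for `P, ρ > 0`,
`ρ²P/4 ≤ |{0 ≤ x₂ ≤ P, r ≤ ρ/2}| ≤ ρ²P` (inner box `|x₀|,|x₁| ≤ ρ/4`, outer box
`|x₀|,|x₁| ≤ ρ/2`). [cite: LeiRenZhang2019, §3 after (3.7) ("we just used |D_R| ∼ R² for large R"), arXiv p. 7] -/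
theorem volume_real_halfPeriodBox {P ρ : ℝ} (hP : 0 < P) (hρ : 0 < ρ) :
    volume {x : EuclideanSpace ℝ (Fin 3) | x 2 ∈ Icc 0 P ∧ cylRadius x ≤ ρ / 2} ≠ ∞ ∧
    ρ ^ 2 * P / 4 ≤ volume.real {x : EuclideanSpace ℝ (Fin 3) | x 2 ∈ Icc 0 P ∧ cylRadius x ≤ ρ / 2} ∧
    volume.real {x : EuclideanSpace ℝ (Fin 3) | x 2 ∈ Icc 0 P ∧ cylRadius x ≤ ρ / 2} ≤ ρ ^ 2 * P := by
  set K : Set (EuclideanSpace ℝ (Fin 3)) := {x | x 2 ∈ Icc 0 P ∧ cylRadius x ≤ ρ / 2} with hK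
  set Bs : Set (EuclideanSpace ℝ (Fin 3)) := {x | |x 0| ≤ ρ / 4 ∧ |x 1| ≤ ρ / 4 ∧ x 2 ∈ Icc 0 P} with hBs
  set Bb : Set (EuclideanSpace ℝ (Fin 3)) := {x | |x 0| ≤ ρ / 2 ∧ |x 1| ≤ ρ / 2 ∧ x 2 ∈ Icc 0 P} with hBb
  have hVs : volume Bs = ENNReal.ofReal (2 * (ρ / 4) * (2 * (ρ / 4)) * P) :=
    volume_box_Icc_phb (by positivity)
  have hVb : volume Bb = ENNReal.ofReal (2 * (ρ / 2) * (2 * (ρ / 2)) * P) :=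
    volume_box_Icc_phb (by positivity)
  have hVb_top : volume Bb ≠ ∞ := by rw [hVb]; exact ENNReal.ofReal_ne_top
  have hsub_b : K ⊆ Bb := by
    rintro x ⟨hx2, hr⟩
    have h := abs_apply_le_cylRadius_phb x
    exact ⟨h.1.trans hr, h.2.trans hr, hx2⟩
  have hsub_s : Bs ⊆ K := by
    rintro x ⟨h0, h1, hx2⟩
    refine ⟨hx2, ?_⟩
    have hsq : cylRadius x ^ 2 ≤ (ρ / 2) ^ 2 := by
      rw [cylRadius_sq]; nlinarith [abs_nonneg (x 0), abs_nonneg (x 1), sq_abs (x 0), sq_abs (x 1)]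
    exact (pow_le_pow_iff_left₀ (cylRadius_nonneg x) (by positivity) two_ne_zero).1 hsq
  have hK_top : volume K ≠ ∞ := ((measure_mono hsub_b).trans_lt (hVb_top.lt_top)).ne
  refine ⟨hK_top, ?_, ?_⟩
  · calc ρ ^ 2 * P / 4 = volume.real Bs := by
          rw [measureReal_def, hVs, ENNReal.toReal_ofReal (by positivity)]; ring
      _ ≤ volume.real K := measureReal_mono hsub_s hK_top
  · calc volume.real K ≤ volume.real Bb := measureReal_mono hsub_b hVb_top
      _ = ρ ^ 2 * P := by rw [measureReal_def, hVb, ENNReal.toReal_ofReal (by positivity)]; ring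

/-- **Continuity in time of the quarter-power mass on the half period box**: for a jointly
continuous space–time `F`, `s ↦ ∫_{K₂} F(s,x)^{1/4} dx` is continuous
(`K₂ = {0 ≤ x₂ ≤ P, r ≤ ρ/2}` compact). Used to build the set of times of large mass ((3.11)). [cite: LeiRenZhang2019, §3 (3.11)–(3.12) (the set W ⊂ [−R², 0] of times where ∫_{D_{R/2}}ζ_R²Λ ≥ ½M₀R²), arXiv p. 8] -/
theorem continuous_setIntegral_halfPeriodBox_rpow_quarter {P ρ : ℝ}
    {F : ℝ → EuclideanSpace ℝ (Fin 3) → ℝ}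
    (hFc : Continuous fun p : ℝ × EuclideanSpace ℝ (Fin 3) => F p.1 p.2) :
    Continuous fun s => ∫ x in {x : EuclideanSpace ℝ (Fin 3) | x 2 ∈ Icc 0 P ∧ cylRadius x ≤ ρ / 2},
      F s x ^ (1 / 4 : ℝ) := by
  have h := continuous_parametric_integral_of_continuous (μ := (volume : Measure (EuclideanSpace ℝ (Fin 3))))
    (f := fun s x => F s x ^ (1 / 4 : ℝ)) (hFc.rpow_const fun p => Or.inr (by norm_num))
    (isCompact_halfPeriodBox P (ρ / 2))
  exact h

/-- **Mass on the half period box ⇒ weighted slab mass** (the slice step behind (3.11)–(3.12)):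
for `P, ρ > 0`, `F` continuous with `F ≥ 0` on `{r ≤ ρ}`, and `θ ≥ 0` with
`θ ≤ ∫_{K₂} F^{1/4}` (`K₂ = {0 ≤ x₂ ≤ P, r ≤ ρ/2}`),
`(16/27) θ⁴/(ρ²P)³ ≤ ∫_{zSlab P 0} F ζ²` for `ζ = cylCutoff (ρ/2) ρ` (`ζ = 1` on `K₂`,
`|K₂| ≤ ρ²P`, Hölder). [cite: LeiRenZhang2019, §3 (3.1) ⇒ (3.11)–(3.12) ("we just used |D_R| ∼ R² for large R"), arXiv pp. 7–8] -/
theorem slab_mass_of_quarter_mass_periodic {P ρ θ : ℝ} (hP : 0 < P) (hρ : 0 < ρ)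
    {F : EuclideanSpace ℝ (Fin 3) → ℝ} (hF : Continuous F)
    (hF0 : ∀ x, cylRadius x ≤ ρ → 0 ≤ F x) (hθ0 : 0 ≤ θ)
    (hθ : θ ≤ ∫ x in {x : EuclideanSpace ℝ (Fin 3) | x 2 ∈ Icc 0 P ∧ cylRadius x ≤ ρ / 2}, F x ^ (1 / 4 : ℝ)) :
    16 / 27 * θ ^ 4 / (ρ ^ 2 * P) ^ 3 ≤ ∫ x in zSlab P 0, F x * cylCutoff (ρ / 2) ρ x ^ 2 := by
  set K : Set (EuclideanSpace ℝ (Fin 3)) := {x | x 2 ∈ Icc 0 P ∧ cylRadius x ≤ ρ / 2} with hK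
  obtain ⟨hK_top, hVlo, hVhi⟩ := volume_real_halfPeriodBox hP hρ
  have hKc : IsCompact K := isCompact_halfPeriodBox P (ρ / 2)
  have hKm : MeasurableSet K := hKc.isClosed.measurableSet
  have hVpos : 0 < volume.real K := lt_of_lt_of_le (by positivity) hVlo
  have hρ2 : 0 ≤ ρ / 2 := by positivity
  have hρρ : ρ / 2 < ρ := half_lt_self hρ
  set ζ : EuclideanSpace ℝ (Fin 3) → ℝ := cylCutoff (ρ / 2) ρ with hζ
  have hζc : Continuous ζ := (contDiff_cylCutoff (ρ / 2) ρ (n := 0)).continuous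
  have hζ1 : ∀ x, cylRadius x ≤ ρ / 2 → ζ x = 1 := fun x hx => cylCutoff_eq_one hρ2 hρρ hx
  have hζ0 : ∀ x, ρ ≤ cylRadius x → ζ x = 0 := fun x hx => cylCutoff_eq_zero hρ2 hρρ hx
  have hF0K : ∀ x ∈ K, 0 ≤ F x := fun x hx => hF0 x (hx.2.trans hρρ.le)
  have hFi : IntegrableOn F K volume := hF.continuousOn.integrableOn_compact hKc
  have hFqi : IntegrableOn (fun x => F x ^ (1 / 4 : ℝ)) K volume :=
    (hF.rpow_const fun x => Or.inr (by norm_num)).continuousOn.integrableOn_compact hKc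
  -- Hölder on `K`
  have hAM := setIntegral_ge_of_setIntegral_rpow_quarter hKm hK_top hVpos hF0K hFi hFqi
  -- `θ⁴/(ρ²P)³ ≤ (∫_K F^{1/4})⁴ / |K|³`
  have hI0 : 0 ≤ ∫ x in K, F x ^ (1 / 4 : ℝ) := hθ0.trans hθ
  have h1 : 16 / 27 * θ ^ 4 / (ρ ^ 2 * P) ^ 3 ≤
      16 / 27 * (∫ x in K, F x ^ (1 / 4 : ℝ)) ^ 4 / volume.real K ^ 3 := by
    have hθ4 : θ ^ 4 ≤ (∫ x in K, F x ^ (1 / 4 : ℝ)) ^ 4 := pow_le_pow_left₀ hθ0 hθ 4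
    have hV3 : volume.real K ^ 3 ≤ (ρ ^ 2 * P) ^ 3 := pow_le_pow_left₀ hVpos.le hVhi 3
    have hV30 : 0 < volume.real K ^ 3 := by positivity
    calc 16 / 27 * θ ^ 4 / (ρ ^ 2 * P) ^ 3 ≤ 16 / 27 * θ ^ 4 / volume.real K ^ 3 :=
          div_le_div_of_nonneg_left (by positivity) hV30 hV3
      _ ≤ 16 / 27 * (∫ x in K, F x ^ (1 / 4 : ℝ)) ^ 4 / volume.real K ^ 3 :=
          div_le_div_of_nonneg_right (by nlinarith) hV30.le
  -- `∫_K F = ∫_{slab ∩ {r ≤ ρ/2}} F ζ² ≤ ∫_{slab} F ζ²`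
  have hset : ∫ x in K, F x = ∫ x in zSlab P 0 ∩ {x | cylRadius x ≤ ρ / 2}, F x * ζ x ^ 2 := by
    rw [← setIntegral_congr_set (zSlab_inter_cylinder_ae_eq_periodBox P (ρ / 2))]
    refine setIntegral_congr_fun ((measurableSet_zSlab P 0).inter
      (measurableSet_le continuous_cylRadius.measurable measurable_const)) fun x hx => ?_
    rw [hζ1 x hx.2, one_pow, mul_one]
  have hiS : IntegrableOn (fun x => F x * ζ x ^ 2) (zSlab P 0) volume :=
    integrableOn_zSlab_of_eq_zero_of_le_cylRadius (hF.mul (hζc.pow 2)) (ρ := ρ)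
      (fun x hx => by simp [hζ0 x hx]) P 0
  have hmono : ∫ x in zSlab P 0 ∩ {x | cylRadius x ≤ ρ / 2}, F x * ζ x ^ 2 ≤
      ∫ x in zSlab P 0, F x * ζ x ^ 2 := by
    refine setIntegral_mono_set hiS ?_ (Eventually.of_forall inter_subset_left)
    refine (ae_restrict_iff' (measurableSet_zSlab P 0)).2 (ae_of_all _ fun x _ => ?_)
    show (0 : ℝ) ≤ F x * ζ x ^ 2
    by_cases hx : cylRadius x ≤ ρ
    · exact mul_nonneg (hF0 x hx) (sq_nonneg _)
    · rw [hζ0 x (not_le.1 hx).le]; simp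
  calc 16 / 27 * θ ^ 4 / (ρ ^ 2 * P) ^ 3
      ≤ 16 / 27 * (∫ x in K, F x ^ (1 / 4 : ℝ)) ^ 4 / volume.real K ^ 3 := h1
    _ ≤ ∫ x in K, F x := hAM
    _ = ∫ x in zSlab P 0 ∩ {x | cylRadius x ≤ ρ / 2}, F x * ζ x ^ 2 := hset
    _ ≤ ∫ x in zSlab P 0, F x * ζ x ^ 2 := hmono

end LeiRenZhang2019

end Literature.Analysis.FluidPDE

end
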